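import Summits.Ventures.PercRepro.C041TreeZoneBridge

/-!
# ROW C-041 — tree zones as zones WITH FORCED EDGES: `ZoneOCubeConjF` and `ZoneCSConjF` on every tree zone
(p6, gen 29; C-041.md §13, §14 (a), §18 — the crux of the typed chain is the abstract `ZoneOCubeConjF`)

A zone is a zone with forced edges in which every edge is free and nothing is isolated (`ZoneData.toFZone`); every
state respects its (absent) forcing (`forced_toFZone`), so its forced admissible states are its admissible states
(`AsetF_toFZone`), its forced sums and counts are the plain ones (`zoneOCubeF_toFZone`, `nValidF_toFZone`, …), and
the forced conjectures are the plain ones (`zoneOCubeConjF_toFZone_iff`, `zoneCSConjF_toFZone_iff`).  Hence, with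
`C041TreeZoneBridge`:

* **`TZ.zoneOCubeConjF_toZone`** — `ZoneOCubeConjF` (the single open statement of the typed chain, §18) holds on
  the zone of every rooted marked tree with its root as the single anchor;
* **`TZ.zoneCSConjF_toZone`** — `ZoneCSConjF` likewise.
-/

namespace PercRepro

namespace ZoneZ

namespace ZoneData

open Finset

variable {V E T₁ T₂ : Type*} (Z : ZoneData V E T₁ T₂)

/-- A zone as a zone with forced edges: every edge free, nothing isolated. -/
def toFZone : FZone V E T₁ T₂ :=
  { Z with
    free := fun _ => True
    fcol := fun _ => true
    iso := ∅
    fblue_mem := fun _ h => (h trivial).elim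
    iso_forced := fun _ h _ => by
      rcases h with h | h <;> exact (Set.mem_empty_iff_false _).1 h
    iso_unmarked₁ := fun _ h => (Set.mem_empty_iff_false _).1 h
    iso_unmarked₂ := fun _ h => (Set.mem_empty_iff_false _).1 h }

/-- The underlying zone is the zone. -/
theorem toFZone_toZoneData : Z.toFZone.toZoneData = Z := rfl

/-- Every state respects the absent forcing. -/
theorem forced_toFZone (σ : State E T₁ T₂) : Z.toFZone.Forced σ := fun _ h => (h trivial).elim

section Sums

variable [Fintype E] [DecidableEq E] [Fintype T₁] [DecidableEq T₁] [Fintype T₂] [DecidableEq T₂] (A Q : Set V)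

/-- The forced admissible states of `toFZone` are the admissible states. -/
theorem AsetF_toFZone : Z.toFZone.AsetF Q = Z.Aset Q := by
  classical
  ext σ
  unfold FZone.AsetF Aset
  rw [Finset.mem_filter, Finset.mem_filter]
  exact and_congr Iff.rfl (and_iff_right (Z.forced_toFZone σ))

/-- The forced ZONE O-CUBE sum of `toFZone` is the plain one. -/
theorem zoneOCubeF_toFZone : Z.toFZone.zoneOCubeF A Q = Z.zoneOCube A Q := by
  unfold FZone.zoneOCubeF zoneOCube
  rw [AsetF_toFZone]
  rfl

/-- The forced valid count of `toFZone` is the plain one. -/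
theorem nValidF_toFZone : Z.toFZone.nValidF A Q = Z.nValid A Q := by
  unfold FZone.nValidF nValid
  rw [AsetF_toFZone]
  rfl

/-- The forced `G1` count of `toFZone` is the plain one. -/
theorem nG1F_toFZone : Z.toFZone.nG1F A Q = Z.nG1 A Q := by
  unfold FZone.nG1F nG1
  rw [AsetF_toFZone]
  rfl

/-- The forced `G2` count of `toFZone` is the plain one. -/
theorem nG2F_toFZone : Z.toFZone.nG2F A Q = Z.nG2 A Q := by
  unfold FZone.nG2F nG2
  rw [AsetF_toFZone]
  rfl

/-- The forced ZONE O-CUBE conjecture on `toFZone` is the plain one. -/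
theorem zoneOCubeConjF_toFZone_iff : Z.toFZone.ZoneOCubeConjF A Q ↔ Z.ZoneOCubeConj A Q := by
  unfold FZone.ZoneOCubeConjF ZoneOCubeConj
  rw [zoneOCubeF_toFZone]

/-- The forced ZONE (CS) conjecture on `toFZone` is the plain one. -/
theorem zoneCSConjF_toFZone_iff : Z.toFZone.ZoneCSConjF A Q ↔ Z.ZoneCSConj A Q := by
  unfold FZone.ZoneCSConjF ZoneCSConj
  rw [nValidF_toFZone, nG1F_toFZone, nG2F_toFZone]

end Sums

end ZoneData

end ZoneZ

namespace TreeClosure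

open ZoneZ ZoneZ.ZoneData

/-- **`ZoneOCubeConjF` ON TREE ZONES**: the abstract conjecture with forced edges of the typed chain (C-041.md
§14 (a), §18) holds on the zone of every rooted marked tree (no forced edge), with its root as the single anchor. -/
theorem TZ.zoneOCubeConjF_toZone (t : TZ) : t.toZone.toFZone.ZoneOCubeConjF {t.root} (∅ : Set t.Pos) :=
  (zoneOCubeConjF_toFZone_iff _ _ _).2 t.zoneOCubeConj_toZone

/-- **`ZoneCSConjF` ON TREE ZONES**: the forced-edge (CS) conjecture (C-041.md §17 (d)) holds on the zone of every
rooted marked tree, with its root as the single anchor. -/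
theorem TZ.zoneCSConjF_toZone (t : TZ) : t.toZone.toFZone.ZoneCSConjF {t.root} (∅ : Set t.Pos) :=
  (zoneCSConjF_toFZone_iff _ _ _).2 t.zoneCSConj_toZone

end TreeClosure

end PercRepro
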